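import Summits.HodgeConjecture.HodgeConjecture.Theses.HeckePrymWeil
import Summits.HodgeConjecture.HodgeConjecture.Theorems.HeckePrymWeilWeilTenfoldsSqrtMinus11TensorAnchorPerryPol
import HarnessLib

/-!
# `WeilSixfoldsSqrtMinus7` (stmt-HodgeConjecture-1260) ⟸ `DeligneWeilFamily` ∧ Perry full ∧ `ch` ∧ hyperbolic flatness ∧ Markman split ∧ S⁺_sh(7,3)
# — the reduction theorem of line `semihomogeneous-perry-design`, by name (sorry-free)

Route `HeckePrymWeil` (sub-problem `HodgeConjecture`); line lead c12 of crux `WeilSixfoldsSqrtMinus7`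
(stmt-HodgeConjecture-1260), 2026-08-17.  The crux-strategist s2's ALTERNATIVE line
`Cruxes/WeilSixfoldsSqrtMinus7/Lines/semihomogeneous_perry_design.lean` (the SHEAF twin at `(p,k) = (7,3)` of the cycle line
`semiregular-clean-lci-six`; registered skeleton r2, sha 04013122) reduces the crux — the Hodge conjecture for the `ℚ(√-7)` Weil
classes of EVERY complex abelian sixfold — to six inputs: (1) `DeligneWeilFamily` (route item stmt-16866, OPEN, XL); (2) Perry's
full-semiregularity theorem `Perry2026_semiregularFull_remainsAlgebraic` (named claim-fact, TRUE in print); (3) a standard Chern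
character `Nonempty StandardChernCharacterBetti` (construction debt); (4) HYPERBOLIC FLATNESS along a `√-7` Weil family of sixfolds
with a global `g` and a global rational degree-2 class (`stub_hyperbolicFlat` of the skeleton, spelled out; provable on the tree's
`transportFun` API); (5) Markman's theorem for hyperbolic sixfolds `Markman2025_weilClasses_algebraic_hyperbolicSixfold` (named fact,
p85530); (6) **S⁺_sh(7,3)** = the line's hardest stub `stub_polarisedSemiregularBundleSix`, spelled out: on every tensor-type `√-7`
sixfold, for every `K`-symmetrised hyperplane class `θ` and every non-zero rational `(3,3)` Weil class `x`, EITHER `(Y,Ψ,θ)` is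
hyperbolic OR there is a finite locally free, fully semiregular `E₀` with `ch(E₀) ∈ ℚ[θ] ⊕ ℚˣ·x` (OPEN; Bloch–BF-(7.5)-type
existence; the strategist's F3-derivation no-go already retires naive semi-homogeneous designs).

This file LANDS that reduction as ONE theorem whose conclusion is the route decl BY NAME,
`weilSixfoldsSqrtMinus7_of_semihomogeneousPerryDesign` (registered sub-goal of the item): the strategist's sorry-free composition
(the `(7,3)` port of the landed `TensorAnchorPerryPol.stub_perryRouteCompositionPol` of crux 1262 v3) verbatim — typing upgrade
(`stub_upgrade`), Deligne's family as global action with the Weil section `σ` through `c` (`hodgeWeilSectionG_of_globalAction`),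
rationality along `σ`, identity principle, the PROVED Leray engine, one projective space for all fibres, the GLOBAL `K`-symmetrised
class `Θ_K = 7·ε^*a + g^*ε^*a`, a case split AT THE ANCHOR (hyperbolic ⟹ `A` hyperbolic by (4) ⟹ Markman (5); otherwise (3)+(6)
give `E₀`, `engine_of_perry` with (2) makes `q₃Θ_K³ + r·W` algebraic at `s₁`, subtract the algebraic `Θ_K³` (Lefschetz (1,1) +
Kleiman on the abelian `A`), divide by `r`, return along the chart).  CONDITIONAL on its six hypotheses by design (like p140104 for the
cycle line); no `sorry`, no definition.
-/

noncomputable section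

set_option linter.dupNamespace false

open CategoryTheory AlgebraicGeometry Limits MonoidalCategory CartesianMonoidalCategory
open Literature.AlgebraicGeometry Literature.AlgebraicGeometry.Motives
  Literature.AlgebraicGeometry.HodgeTheory
open Literature.AlgebraicTopology.SingularHomology
open Summit.HodgeConjecture.HodgeConjecture.Theorems.HeckePrymWeilLine
  (stub_upgrade stub_rationalAlongSection gcs_section_eq_of_eq owf_isoTransport
    stub_globalClassOfSection_of_leray deligneWeilFamilyDecl_iff_kAction)
open Summit.HodgeConjecture.HodgeConjecture.Theorems.HyperbolicEightfoldsSqrtMinus7.AnchorObject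
  (engine_of_perry complexBetti_map_cupPowTwo cupPowTwo_mem_algebraicClasses_abelian)
open Summit.HodgeConjecture.HodgeConjecture.Theorems.WeilTenfoldsSqrtMinus11.TensorAnchorPerryPol
  (hodgeWeilSectionG_of_globalAction)

namespace Summit.HodgeConjecture.HodgeConjecture.Theorems.HeckePrymWeilLine.SemihomogeneousPerryDesign

/-! ### The reduction (concludes the crux BY NAME; `(7,3)` port of `stub_perryRouteCompositionPol`) -/

/-- **MAIN THEOREM — `WeilSixfoldsSqrtMinus7` from the six inputs taken as HYPOTHESES**, by name (`(7,3)` port of the landed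
`TensorAnchorPerryPol.stub_perryRouteCompositionPol`; sorry-free).  Given `(A, φ)` and a non-zero rational `(3,3)` class `c`
of the typed plane: upgrade to the strong plane (`stub_upgrade`, landed); Stub 1 gives the family `f : 𝒳 → S`
through `e : A ≅ 𝒳_{s₁}` with `g`, the continuous Weil section `σ` through `c`, fibrewise Hodge
(`hodgeWeilSectionG_of_globalAction`, landed), rational along `σ` (`stub_rationalAlongSection`, landed),
globalised to `W ∈ H⁶(𝒳)` by the PROVED Leray engine, and the anchor `e₀ : Y ≅ 𝒳_{s₀}` with `σ(s₀)` in the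
strong Weil plane of `(Y, Ψ)` and `σ(s₀) ≠ 0` (identity principle); the fibres embed in one `ℙᵐ` by `ε`, a
non-zero rational `a ∈ H²(ℙᵐ)` exists and `Θ_K := 7·ε^*a + g^*ε^*a` is a GLOBAL class with rational `(1,1)`
fibre restrictions; at `s₀` it is `e₀`-transported to the bet's `θ`; at a HYPERBOLIC anchor Stub 5 makes `A` hyperbolic and Stub 6 concludes; otherwise Stubs 3–4 give `E₀` on `𝒳_{s₀}`;
`engine_of_perry` (Stub 2) makes `q₃·Θ_K|_{s₁}³ + r·W|_{s₁}` algebraic; `Θ_K|_{s₁}³` is algebraic on the abelian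
`A ≅ 𝒳_{s₁}` (Lefschetz `(1,1)`, discharged, + Kleiman); hence `r·e^{-1*}c`, hence `c`, is algebraic
(`IsoInvariance`, proved).  CONDITIONAL: nothing is asserted beyond the four hypotheses.
[cite: Deligne1982HodgeCycles, proof of Thm. 4.8 (pp. 47–52) with Prop. 4.4]
[cite: Perry2026Semiregularity, Thm. 1.1 (2)] [cite: VoisinHodgeII2003, Thm. 4.18 and §9.2.4 Prop. 9.20] -/
theorem weilSixfoldsSqrtMinus7_of_semihomogeneousPerryDesign :
    Summit.HodgeConjecture.HodgeConjecture.Theses.HeckePrymWeil.DeligneWeilFamily →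
    Perry2026_semiregularFull_remainsAlgebraic → Nonempty StandardChernCharacterBetti →
    (∀ (𝒳 S : SchemeOver ℂ) (f : 𝒳 ⟶ S) (g : 𝒳 ⟶ 𝒳), IsSmoothProjectiveFamily f (2 * 3) → IrreducibleSpace S.left → AlgebraicGeometry.Smooth S.hom → IsQuasiProjectiveOver S → g ≫ f = f → ∀ (Θ : complexBetti 𝒳 2), (∀ s : ComplexPoints S, IsRationalClass (complexBetti.map (fiberι f s) 2 Θ)) → ∀ (s s' : ComplexPoints S) (A : AbelianVariety ℂ) (φ : A ⟶ A) (e : A.X ≅ fiberOver f s) (A' : AbelianVariety ℂ) (φ' : A' ⟶ A') (e' : A'.X ≅ fiberOver f s'), A.dim = 2 * 3 → A'.dim = 2 * 3 → φ ≫ φ = -((7 : ℤ) • 𝟙 A) → φ' ≫ φ' = -((7 : ℤ) • 𝟙 A') → (e.hom ≫ fiberι f s) ≫ g = φ.hom.hom.hom ≫ (e.hom ≫ fiberι f s) → (e'.hom ≫ fiberι f s') ≫ g = φ'.hom.hom.hom ≫ (e'.hom ≫ fiberι f s') → Literature.AlgebraicGeometry.Motives.IsHyperbolicWeilType A φ 3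 (complexBetti.map e.hom 2 (complexBetti.map (fiberι f s) 2 Θ)) → Literature.AlgebraicGeometry.Motives.IsHyperbolicWeilType A' φ' 3 (complexBetti.map e'.hom 2 (complexBetti.map (fiberι f s') 2 Θ))) →
    Markman2025_weilClasses_algebraic_hyperbolicSixfold →
    (∀ (C : StandardChernCharacterBetti) (Y : AbelianVariety ℂ) (Ψ : Y ⟶ Y) (A₁ : AbelianVariety ℂ) (f₁ : Y ⟶ A₁.prod A₁) (g₁ : A₁.prod A₁ ⟶ Y) (m : ℕ), A₁.dim = 3 → Y.dim = 6 → Ψ ≫ Ψ = -((7 : ℤ) • 𝟙 Y) → 0 < m → f₁ ≫ g₁ = m • 𝟙 Y → AlgebraicGeometry.Flat f₁.hom.hom.hom.left → g₁ ≫ Ψ = AbelianVariety.prodLift (AbelianVariety.snd A₁ A₁ ≫ (-((7 : ℤ) • 𝟙 A₁))) (AbelianVariety.fst A₁ A₁) ≫ g₁ → ∀ (ι : ProjectiveEmbedding Y.X) (a : complexBetti (projectiveSpace ι.n ℂ) 2), IsRationalClass a → a ≠ 0 → ∀ (x : complexBetti Y.X (2 * 3)), IsRationalClass x → IsOfHodgeType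 6 Y.X (2 * 3) 3 3 x → x ∈ weilClassesOf Y Ψ 3 7 → x ≠ 0 → Literature.AlgebraicGeometry.Motives.IsHyperbolicWeilType Y Ψ 3 ((7 : ℂ) • complexBetti.map ι.ι 2 a + complexBetti.map Ψ.hom.hom.hom 2 (complexBetti.map ι.ι 2 a)) ∨ ∀ (F₀ : SchemeOver ℂ) (e₀ : Y.X ≅ F₀), ∃ (E₀ : F₀.left.Modules) (hE₀ : IsFiniteLocallyFree E₀) (q : ℕ → ℚ) (r : ℚ), r ≠ 0 ∧ IsISemiregular hE₀ Set.univ ∧ (∀ k : ℕ, k ≠ 3 → C.ch F₀ E₀ k = ((q k : ℚ) : ℂ) • complexBetti.map e₀.inv (2 * k) (cupPowTwo ((7 : ℂ) • complexBetti.map ι.ι 2 a + complexBetti.map Ψ.hom.hom.hom 2 (complexBetti.map ι.ι 2 a)) k)) ∧ C.ch F₀ E₀ 3 = complexBetti.map e₀.inv (2 * 3) (((q 3 : ℚ) : ℂ) • cupPowTwo ((7 : ℂ) • complexBetti.map ι.ι 2 a + complexBetti.map Ψ.hom.hom.hom 2 (complexBetti.map ι.ι 2 a)) 3 + ((r : ℚ)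 : ℂ) • x)) →
    Summit.HodgeConjecture.HodgeConjecture.Theses.HeckePrymWeil.WeilSixfoldsSqrtMinus7 := by
  intro hF hP hC hFlat hM hB A φ hA hφ c hr hH hW
  by_cases hc : c = 0
  · rw [hc]
    exact Submodule.zero_mem _
  -- casts: the packages are stated for a variable prime `p`, here `p = 7`, at degree `2 * 3`
  have hφ' : φ ≫ φ = -(((7 : ℕ) : ℤ) • 𝟙 A) := by exact_mod_cast hφ
  have hA' : A.dim = 2 * 3 := hA
  -- typing upgrade (landed): the single-operator plane lies in the strong Weil plane
  have hcW : c ∈ weilClassesOf A φ 3 7 := by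
    refine stub_upgrade 7 (by norm_num) (by norm_num) (by norm_num) 3 A φ hA' hφ' ?_
    exact_mod_cast hW
  -- the route item, as the abelian scheme with `K`-action (landed equivalences), with the action KEPT
  have hK : deligne1982_weilFamily_kAction := deligneWeilFamilyDecl_iff_kAction.mp hF
  have hG : deligne1982_weilFamily_globalAction := deligne1982_weilFamily_globalAction_of_kAction hK
  obtain ⟨𝒳, S, f, g, s₁, s₀, e, σ, hfam, hemb, hirr, hsm, hSqp, hg, hfib, he, hσc, hpt, hHσ, hs₁, Y, Ψ,
    e₀, x, ⟨A₁, f₁, g₁, m, hA₁, hY, hΨ, hm, hfg, hf₁, hg₁⟩, he₀, hs₀, hx⟩ :=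
    hodgeWeilSectionG_of_globalAction hG 7 (by norm_num) (by norm_num) (by norm_num) 3 (by norm_num) A φ hA'
      hφ' c hcW hc hr hH
  -- rationality along the section (landed)
  have hrat₁ : IsRationalClass (σ s₁).cls := by
    rw [hs₁]; exact hr.map _
  have hratσ : ∀ s, IsRationalClass (σ s).cls :=
    stub_rationalAlongSection f (2 * 3) (2 * 3) hfam hsm hSqp hirr σ hσc hpt s₁ hrat₁
  have hratx : IsRationalClass x := by
    have h := hratσ s₀
    rwa [hs₀] at h
  have hHx : IsOfHodgeType 6 (fiberOver f s₀) (2 * 3) 3 3 x := by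
    have h := hHσ s₀
    rw [hs₀] at h
    exact h
  -- the base is a connected manifold; `R• f_* ℂ` is a local system on it
  haveI := hsm
  haveI := hirr
  haveI : LocallyOfFiniteType S.hom := hSqp.locallyOfFiniteType
  haveI : ConnectedSpace (ComplexPoints S) :=
    (ComplexPoints.connectedSpace_iff_holds S).2 inferInstance
  obtain ⟨dS, hdS⟩ := exists_smoothOfRelativeDimension_of_connectedSpace_complexPoints S
  haveI := hdS
  haveI := pathConnectedSpace_complexPoints_of_smoothOfRelativeDimension S dS
  have hU := isCohomologicallyLocallyTrivialOn_univ_of_isSmoothProjectiveFamily f dS hfam hSqp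
  -- `x ≠ 0`: a continuous section vanishing at `s₀` vanishes identically (identity principle, landed)
  have hx0 : x ≠ 0 := by
    intro hx0
    have hzero : σ s₀ = globalSection f (2 * 3) 0 s₀ := by
      rw [hs₀, hx0]
      show (⟨s₀, 0⟩ : FiberClass f (2 * 3)) = ⟨s₀, _⟩
      rw [map_zero]
    have hall := gcs_section_eq_of_eq f (2 * 3) hU hσc hpt (continuous_globalSection f _ 0)
      (fun _ => rfl) hzero s₁
    rw [hs₁] at hall
    have hc' : complexBetti.map e.inv (2 * 3) c = 0 := by
      have h2 := ((FiberClass.clsAt_eq_iff _ rfl _).2 hall.symm).symm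
      rw [h2]
      show complexBetti.map (fiberι f s₁) (2 * 3) 0 = 0
      rw [map_zero]
    apply hc
    have h3 := congrArg (complexBetti.map e.hom (2 * 3)) hc'
    rwa [map_zero, ← CategoryTheory.comp_apply, ← complexBetti.map_comp, Iso.hom_inv_id,
      complexBetti.map_id, CategoryTheory.id_apply] at h3
  -- the PROVED Leray engine: `σ` is the restriction of a global class `W`
  obtain ⟨W, hWσ⟩ := stub_globalClassOfSection_of_leray deligne1968_invariantClass_fromTotalSpace_holds f (2 * 3)
    (2 * 3) hfam hemb hsm hSqp hirr σ hσc hpt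
  have hcls : ∀ (s : ComplexPoints S) (y : complexBetti (fiberOver f s) (2 * 3)),
      σ s = ⟨s, y⟩ → complexBetti.map (fiberι f s) (2 * 3) W = y := by
    intro s y hy
    have h := (hWσ s).symm.trans hy
    simp only [globalSection, FiberClass.mk.injEq, heq_eq_eq, true_and] at h
    exact h
  have hW₁ : complexBetti.map (fiberι f s₁) (2 * 3) W = complexBetti.map e.inv (2 * 3) c := hcls s₁ _ hs₁
  have hW₀ : complexBetti.map (fiberι f s₀) (2 * 3) W = x := hcls s₀ x hs₀
  have hWrat : ∀ s, IsRationalClass (complexBetti.map (fiberι f s) (2 * 3) W) := by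
    intro s
    have h := hratσ s
    rw [hWσ s] at h
    exact h
  have hWH : ∀ s, IsOfHodgeType (2 * 3) (fiberOver f s) (2 * 3) 3 3 (complexBetti.map (fiberι f s) (2 * 3) W) := by
    intro s
    have h := hHσ s
    rw [hWσ s] at h
    exact h
  -- the fibre maps of `g`
  have hgf' := fun t ↦ exists_fiberHom_comp_fiberι f g hg t
  choose gf hgf using hgf'
  -- all fibres embed in ONE projective space `ℙᵐ`, `m ≥ 6`
  obtain ⟨mm, ε, hε⟩ := exists_forall_isClosedImmersion_fiberι_comp f hfam hemb hSqp
  have hPm : IsSmoothProjective mm (projectiveSpace mm ℂ) := isSmoothProjective_projectiveSpace' mm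
  have hmm : 1 ≤ mm := by
    haveI := hε s₀
    obtain ⟨B⟩ := (nonempty_hodgeModel_holds (n := 2 * 3) (X := fiberOver f s₀)).nonempty
      (hfam.isSmoothProjective s₀)
    obtain ⟨Bm⟩ := (nonempty_hodgeModel_holds (n := mm) (X := projectiveSpace mm ℂ)).nonempty hPm
    have h := dim_le_of_isClosedImmersion_projectiveSpace (hfam.isSmoothProjective s₀) (fiberι f s₀ ≫ ε) B Bm
    omega
  obtain ⟨a, ha, ha0⟩ := exists_isRationalClass_ne_zero_projectiveSpace hmm
  have ha11 : IsOfHodgeType mm (projectiveSpace mm ℂ) (2 * 1) 1 1 a :=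
    isOfHodgeType_of_mem_algebraicClasses_of_isSmoothProjective hPm 1
      (by rw [algebraicClasses_projectiveSpace_eq_top]; exact Submodule.mem_top)
  -- the GLOBAL `K`-symmetrised hyperplane class `Θ_K = 7·ε^*a + g^*ε^*a` and its fibre restrictions
  set Θ : complexBetti 𝒳 2 := complexBetti.map ε 2 a with hΘdef
  set ΘK : complexBetti 𝒳 2 := (7 : ℂ) • Θ + complexBetti.map g 2 Θ with hΘKdef
  -- `θ_s := ι_s^* Θ = (ι_s ≫ ε)^* a`
  have hθs : ∀ s, complexBetti.map (fiberι f s) 2 Θ = complexBetti.map (fiberι f s ≫ ε) 2 a := by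
    intro s
    rw [hΘdef, complexBetti.map_comp, ModuleCat.comp_apply]
  have hΘKs : ∀ s, complexBetti.map (fiberι f s) 2 ΘK =
      (7 : ℂ) • complexBetti.map (fiberι f s) 2 Θ +
        complexBetti.map (gf s) 2 (complexBetti.map (fiberι f s) 2 Θ) := by
    intro s
    rw [hΘKdef, map_add, map_smul, ← ModuleCat.comp_apply (complexBetti.map g 2),
      ← complexBetti.map_comp, ← hgf s, complexBetti.map_comp, ModuleCat.comp_apply]
  -- `Θ_K|_{𝒳_s}` is rational of type `(1,1)` on every fibre
  have hΘKfib : ∀ s, IsRationalClass (complexBetti.map (fiberι f s) 2 ΘK) ∧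
      IsOfHodgeType (2 * 3) (fiberOver f s) 2 1 1 (complexBetti.map (fiberι f s) 2 ΘK) := by
    intro s
    have hsp := hfam.isSmoothProjective s
    have hrat' : IsRationalClass (complexBetti.map (fiberι f s) 2 Θ) := by
      rw [hθs s]; exact ha.map _
    have h7' : IsOfHodgeType (2 * 3) (fiberOver f s) 2 1 1 (complexBetti.map (fiberι f s) 2 Θ) := by
      rw [hθs s]; exact ha11.map_of_isSmoothProjective hsp hPm _
    rw [hΘKs s]
    refine ⟨?_, (h7'.smul _).add hsp (h7'.map_of_isSmoothProjective hsp hsp _)⟩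
    have h7 : ((7 : ℚ) : ℂ) • complexBetti.map (fiberι f s) 2 Θ = (7 : ℂ) • complexBetti.map (fiberι f s) 2 Θ := by
      norm_num
    rw [← h7]
    exact (hrat'.smul 7).add (hrat'.map _)
  -- the anchor's embedding `Y ≅ 𝒳_{s₀} ↪ ℙᵐ` and the bet's `K`-symmetrised class `θ` through `e₀`
  haveI : IsIso e₀.hom.left :=
    ⟨e₀.inv.left, by rw [← Over.comp_left, e₀.hom_inv_id, Over.id_left],
      by rw [← Over.comp_left, e₀.inv_hom_id, Over.id_left]⟩
  haveI := hε s₀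
  haveI : IsClosedImmersion (e₀.hom ≫ (fiberι f s₀ ≫ ε)).left := by
    rw [Over.comp_left]
    infer_instance
  let ιY : ProjectiveEmbedding Y.X := ⟨mm, e₀.hom ≫ (fiberι f s₀ ≫ ε), inferInstance⟩
  have he₀' : e₀.hom ≫ gf s₀ = Ψ.hom.hom.hom ≫ e₀.hom :=
    hom_comp_fiberHom_eq_of_comp_fiberι f g (hgf s₀) e₀ Ψ.hom.hom.hom he₀
  have hιa : complexBetti.map ιY.ι 2 a = complexBetti.map e₀.hom 2 (complexBetti.map (fiberι f s₀) 2 Θ) := by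
    show complexBetti.map (e₀.hom ≫ (fiberι f s₀ ≫ ε)) 2 a = _
    rw [complexBetti.map_comp, ModuleCat.comp_apply, hθs s₀]
  have hθY : complexBetti.map e₀.inv 2
      ((7 : ℂ) • complexBetti.map ιY.ι 2 a + complexBetti.map Ψ.hom.hom.hom 2 (complexBetti.map ιY.ι 2 a)) =
      complexBetti.map (fiberι f s₀) 2 ΘK := by
    rw [hιa, map_add, map_smul, e₀.complexBetti_map_inv_map_hom, hΘKs s₀]
    congr 1
    rw [← ModuleCat.comp_apply (complexBetti.map e₀.hom 2), ← complexBetti.map_comp,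
      ← ModuleCat.comp_apply (complexBetti.map (Ψ.hom.hom.hom ≫ e₀.hom) 2), ← complexBetti.map_comp,
      ← he₀', e₀.inv_hom_id_assoc]
  -- the Weil class read on `Y`
  have hxY0 : complexBetti.map e₀.hom (2 * 3) x ≠ 0 := by
    intro h0
    apply hx0
    have h3 := congrArg (complexBetti.map e₀.inv (2 * 3)) h0
    rwa [map_zero, e₀.complexBetti_map_inv_map_hom] at h3
  have hxYH : IsOfHodgeType 6 Y.X (2 * 3) 3 3 (complexBetti.map e₀.hom (2 * 3) x) := hHx.map_of_iso e₀
  -- STUB C: a standard Chern character; STUB B: the polarised semiregular object on `𝒳_{s₀} ≅ Y`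
  obtain ⟨C⟩ := hC
  -- `A` is smooth projective of dimension `6`
  have hAsp : IsSmoothProjective (2 * 3) A.X := by
    have h := AbelianVariety.isSmoothProjective_holds (A := A)
    rw [AbelianVariety.isSmoothProjective, hA'] at h
    exact h
  rcases hB C Y Ψ A₁ f₁ g₁ m hA₁ hY (by exact_mod_cast hΨ) hm hfg hf₁ (by exact_mod_cast hg₁) ιY a ha ha0
      (complexBetti.map e₀.hom (2 * 3) x) (hratx.map _) hxYH hx hxY0 with hhypY | hBet
  · /- HYPERBOLIC ANCHOR: hyperbolicity is flat (Stub 5), so `A` is hyperbolic for the `K`-symmetrised hyperplane class of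
       the embedding `e ≫ ι_{s₁} ≫ ε`, and Markman's theorem (Stub 6) gives the claim directly. -/
    -- the anchor's class `θ_Y` is the `e₀`-transport of `Θ_K|_{s₀}`
    have hθY' : complexBetti.map e₀.hom 2 (complexBetti.map (fiberι f s₀) 2 ΘK) =
        (7 : ℂ) • complexBetti.map ιY.ι 2 a + complexBetti.map Ψ.hom.hom.hom 2 (complexBetti.map ιY.ι 2 a) := by
      rw [← hθY, ← CategoryTheory.comp_apply, ← complexBetti.map_comp, Iso.hom_inv_id, complexBetti.map_id,
        CategoryTheory.id_apply]
    rw [← hθY'] at hhypY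
    -- the embedding of `A` through its chart and the `K`-symmetrised class at `s₁`
    haveI : IsIso e.hom.left :=
      ⟨e.inv.left, by rw [← Over.comp_left, e.hom_inv_id, Over.id_left],
        by rw [← Over.comp_left, e.inv_hom_id, Over.id_left]⟩
    haveI := hε s₁
    haveI : IsClosedImmersion (e.hom ≫ (fiberι f s₁ ≫ ε)).left := by
      rw [Over.comp_left]
      infer_instance
    let ιA : ProjectiveEmbedding A.X := ⟨mm, e.hom ≫ (fiberι f s₁ ≫ ε), inferInstance⟩
    have he' : e.hom ≫ gf s₁ = φ.hom.hom.hom ≫ e.hom :=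
      hom_comp_fiberHom_eq_of_comp_fiberι f g (hgf s₁) e φ.hom.hom.hom he
    have hιAa : complexBetti.map ιA.ι 2 a = complexBetti.map e.hom 2 (complexBetti.map (fiberι f s₁) 2 Θ) := by
      show complexBetti.map (e.hom ≫ (fiberι f s₁ ≫ ε)) 2 a = _
      rw [complexBetti.map_comp, ModuleCat.comp_apply, hθs s₁]
    have hθA : complexBetti.map e.inv 2
        ((7 : ℂ) • complexBetti.map ιA.ι 2 a + complexBetti.map φ.hom.hom.hom 2 (complexBetti.map ιA.ι 2 a)) =
        complexBetti.map (fiberι f s₁) 2 ΘK := by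
      rw [hιAa, map_add, map_smul, e.complexBetti_map_inv_map_hom, hΘKs s₁]
      congr 1
      rw [← ModuleCat.comp_apply (complexBetti.map e.hom 2), ← complexBetti.map_comp,
        ← ModuleCat.comp_apply (complexBetti.map (φ.hom.hom.hom ≫ e.hom) 2), ← complexBetti.map_comp,
        ← he', e.inv_hom_id_assoc]
    have hθA' : complexBetti.map e.hom 2 (complexBetti.map (fiberι f s₁) 2 ΘK) =
        (7 : ℂ) • complexBetti.map ιA.ι 2 a + complexBetti.map φ.hom.hom.hom 2 (complexBetti.map ιA.ι 2 a) := by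
      rw [← hθA, ← CategoryTheory.comp_apply, ← complexBetti.map_comp, Iso.hom_inv_id, complexBetti.map_id,
        CategoryTheory.id_apply]
    -- Stub 5: transport hyperbolicity from the anchor `s₀` to `s₁`
    have hhypA := hFlat 𝒳 S f g hfam hirr hsm hSqp hg ΘK (fun s => (hΘKfib s).1) s₀ s₁ Y Ψ e₀ A φ e hY hA'
      (by exact_mod_cast hΨ) hφ he₀ he hhypY
    rw [hθA'] at hhypA
    -- Stub 6: Markman at `d = 7`
    have hφn : φ ≫ φ = -((7 : ℕ) • 𝟙 A) := by rw [hφ', natCast_zsmul]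
    exact hM 7 (by norm_num) A φ hA' hAsp hφn ιA a ha ha0 hhypA c hr hH hcW
  obtain ⟨E₀, hE₀, q, r, hr0, hsr, hEk, hE3⟩ := hBet (fiberOver f s₀) e₀
  have hrC : ((r : ℚ) : ℂ) ≠ 0 := by exact_mod_cast hr0
  -- the Chern character of `E₀` in terms of the GLOBAL classes `Θ_K`, `r • W`
  have hk : ∀ k : ℕ, k ≠ 3 →
      C.ch (fiberOver f s₀) E₀ k = ((q k : ℚ) : ℂ) • cupPowTwo (complexBetti.map (fiberι f s₀) 2 ΘK) k := by
    intro k hk3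
    rw [hEk k hk3, complexBetti_map_cupPowTwo, hθY]
  have hWrat' : ∀ s, IsRationalClass (complexBetti.map (fiberι f s) (2 * 3) (((r : ℚ) : ℂ) • W)) := by
    intro s
    rw [map_smul]
    exact (hWrat s).smul r
  have hWH' : ∀ s, IsOfHodgeType (2 * 3) (fiberOver f s) (2 * 3) 3 3
      (complexBetti.map (fiberι f s) (2 * 3) (((r : ℚ) : ℂ) • W)) := by
    intro s
    rw [map_smul]
    exact (hWH s).smul _
  have hn : C.ch (fiberOver f s₀) E₀ 3 =
      ((q 3 : ℚ) : ℂ) • cupPowTwo (complexBetti.map (fiberι f s₀) 2 ΘK) 3 +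
        complexBetti.map (fiberι f s₀) (2 * 3) (((r : ℚ) : ℂ) • W) := by
    rw [hE3, map_add, map_smul, map_smul, complexBetti_map_cupPowTwo, hθY, e₀.complexBetti_map_inv_map_hom,
      map_smul, hW₀]
  -- STUB P through the engine: `q₃·Θ_K|_{s₁}³ + r·W|_{s₁}` is algebraic on `𝒳_{s₁}`
  have halg := engine_of_perry hP 3 f hfam hirr hsm hSqp ΘK hΘKfib (((r : ℚ) : ℂ) • W) hWrat' hWH' s₀
    C.toChernCharacterBetti E₀ hE₀ hsr q hk hn s₁
  -- `Θ_K|_{s₁}³` is algebraic on `𝒳_{s₁}`: Lefschetz (1,1) (discharged) + Kleiman on the abelian `A ≅ 𝒳_{s₁}`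
  have hh₁rat : IsRationalClass (complexBetti.map e.hom 2 (complexBetti.map (fiberι f s₁) 2 ΘK)) :=
    (hΘKfib s₁).1.map _
  have hh₁H : IsOfHodgeType (2 * 3) A.X 2 1 1 (complexBetti.map e.hom 2 (complexBetti.map (fiberι f s₁) 2 ΘK)) :=
    (hΘKfib s₁).2.map_of_iso e
  have hh₁alg : complexBetti.map e.hom 2 (complexBetti.map (fiberι f s₁) 2 ΘK) ∈ algebraicClasses A.X 1 :=
    lefschetzOneOne_rational_holds hAsp _ hh₁rat hh₁H
  have hh₁3 : complexBetti.map e.hom (2 * 3) (cupPowTwo (complexBetti.map (fiberι f s₁) 2 ΘK) 3) ∈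
      algebraicClasses A.X 3 := by
    rw [complexBetti_map_cupPowTwo]
    exact cupPowTwo_mem_algebraicClasses_abelian A hh₁alg 2
  have hΘ3 : cupPowTwo (complexBetti.map (fiberι f s₁) 2 ΘK) 3 ∈ algebraicClasses (fiberOver f s₁) 3 :=
    owf_isoTransport _ A e 3 _ hh₁3
  -- hence `r • W_{s₁} = r • e^{-1*} c`, and so `e^{-1*} c` (`r ≠ 0`), is algebraic on `𝒳_{s₁}`
  have hrW₁alg : ((r : ℚ) : ℂ) • complexBetti.map e.inv (2 * 3) c ∈ algebraicClasses (fiberOver f s₁) 3 := by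
    rw [← hW₁, ← map_smul]
    have h := Submodule.sub_mem _ halg (Submodule.smul_mem _ (((q 3 : ℚ) : ℂ)) hΘ3)
    rwa [add_sub_cancel_left] at h
  have h1 : complexBetti.map e.inv (2 * 3) c ∈ algebraicClasses (fiberOver f s₁) 3 :=
    (Submodule.smul_mem_iff _ hrC).mp hrW₁alg
  -- back along `e : A ≅ 𝒳_{s₁}` (the route's proved `IsoInvariance`)
  have key := Theorems.isoInvariance_proof e 3 _ h1
  rw [← CategoryTheory.comp_apply, ← complexBetti.map_comp, Iso.hom_inv_id, complexBetti.map_id] at key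
  exact key

end Summit.HodgeConjecture.HodgeConjecture.Theorems.HeckePrymWeilLine.SemihomogeneousPerryDesign

end
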